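import Summits.CriticalPhenomena.PercolationContinuityZ3.Theorems.Transplant.DiamondFilmSqShadow
import Summits.CriticalPhenomena.PercolationContinuityZ3.Theorems.Transplant.SqShadowVRoutingX
import HarnessLib

/-!
# THE EVEN DIAMOND FILMS `D_{2m}`, `2m ≥ 4`, AT THEIR OWN CRITICAL POINT — MODULO THE EXIT-FORM ROUTING CERTIFICATE `ShapedLinkageX R` ALONE

builds on p205010 (kernel theorem, internal audit signed; external expert review pending) — NOT used in this file.  Lane `prim-bschramm`, seat `prim-bschramm-p2` (gen 42; class C1b;
memo `HOME/bschramm/P2-LATTICES.md` §148); helper file (`--supports stmt-CriticalPhenomena-4575 --as helper`).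
The two structural hypotheses of the thin-instance routing («SqShadowVRoutingX») for the square shadow `uv` of `D_k` («DiamondFilmSqShadow»):
* §1 explicit film vertices `mkV` over a prescribed column and height; **`uv_surjective`** (`k ≥ 3`: the four parity classes of columns are the heights `0, 1, 2, 3 mod 4`);
* §2 **`exists_walk_in_lift_sqBall`**: the lift of every lattice square of radius `≥ 1` is connected inside itself (`k ≥ 2`: every vertex steps down/up to height `1` inside the
  square; height-`1` vertices over the square are joined through heights `0` (horizontal double steps) and `2` (vertical double steps));
* §3 **`diamondFilmOwnCriticalContinuity_of_shapedLinkageX`**: for even `k ≥ 4` and any `R ≥ 1`, `ShapedLinkageX R` for `DiamondFilm.sqShadow` gives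
  `DiamondFilmOwnCriticalContinuity k`.  For `k = 4`, `R = 4` the certificate is a finite computation with one cleared-set template per centre class (memo §148: all
  `384` clip classes verified by search, `d4link`); typing it is the next generation's task.  Independent of p205010.
[cite: DuminilCopinSidoraviciusTassion2016, Thm. 1 and §2.3] [cite: ConwaySloane1999, Ch. 4 §7.3] [cite: BenjaminiSchramm1996, Conj. 4 / Question 3]
-/

noncomputable section

namespace Summit.CriticalPhenomena.PercolationContinuityZ3.Theorems.Transplant

open MeasureTheory Literature.Probability.Percolation Literature.Probability.LatticeModels SimpleGraph Filter
open scoped Classical Topology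

namespace DiamondFilm

variable {k : ℕ}

/-! ## §1 Explicit vertices; every column is inhabited -/

/-- The film vertex with ambient coordinates `(x₀, x₁, ℓ)` (when these are diamond coordinates of height `≤ k`). [cite: ConwaySloane1999, Ch. 4 §7.3] -/
def mkV (x₀ x₁ : ℤ) (ℓ : ℕ) (h : x₀ % 2 = (ℓ : ℤ) % 2 ∧ x₁ % 2 = (ℓ : ℤ) % 2 ∧ ((x₀ + x₁ + ℓ) % 4 = 0 ∨ (x₀ + x₁ + ℓ) % 4 = 3)) (hℓ : ℓ ≤ k) :
    diamondFilm k :=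
  ⟨⟨![x₀, x₁, ℓ], by
    rw [mem_diamondSite_iff]
    simp only [Matrix.cons_val_zero, Matrix.cons_val_one, Matrix.cons_val_two, Matrix.tail_cons, Matrix.head_cons]
    exact h⟩, by
    rw [mem_diamondFilm]
    simp only [Matrix.cons_val_two, Matrix.tail_cons, Matrix.head_cons]
    exact ⟨by positivity, by exact_mod_cast hℓ⟩⟩

/-- Coordinates of `mkV`. [folklore] -/
theorem crd_mkV (x₀ x₁ : ℤ) (ℓ : ℕ) (h) (hℓ : ℓ ≤ k) : crd (mkV x₀ x₁ ℓ h hℓ) 0 = x₀ ∧ crd (mkV x₀ x₁ ℓ h hℓ) 1 = x₁ ∧ crd (mkV x₀ x₁ ℓ h hℓ) 2 = ℓ :=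
  ⟨rfl, rfl, rfl⟩

/-- The shadow of `mkV (a + b) (a − b) ℓ` is `(a, b)`. [folklore] -/
theorem uv_mkV (a b : ℤ) (ℓ : ℕ) (h) (hℓ : ℓ ≤ k) : uv (mkV (a + b) (a - b) ℓ h hℓ) = ![a, b] := by
  obtain ⟨e0, e1⟩ := uv_apply (mkV (k := k) (a + b) (a - b) ℓ h hℓ)
  obtain ⟨c0, c1, -⟩ := crd_mkV (k := k) (a + b) (a - b) ℓ h hℓ
  ext i; fin_cases i
  · show uv _ 0 = a; rw [e0, c0, c1]; omega
  · show uv _ 1 = b; rw [e1, c0, c1]; omega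

/-- **Every column of `ℤ²` is inhabited** (`k ≥ 3`): over `(a, b)` sits the vertex of height `0, 1, 2, 3` according as `(a, b) ≡ (0,0), (1,0), (1,1), (0,1) mod 2`.
[cite: ConwaySloane1999, Ch. 4 §7.3] -/
theorem uv_surjective (hk : 3 ≤ k) : Function.Surjective (uv (k := k)) := by
  intro q
  have hq : q = ![q 0, q 1] := by ext i; fin_cases i <;> rfl
  rcases Int.emod_two_eq_zero_or_one (q 0) with ha | ha <;> rcases Int.emod_two_eq_zero_or_one (q 1) with hb | hb
  · refine ⟨mkV (q 0 + q 1) (q 0 - q 1) 0 ⟨by omega, by omega, by omega⟩ (by omega), by rw [uv_mkV, ← hq]⟩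
  · refine ⟨mkV (q 0 + q 1) (q 0 - q 1) 3 ⟨by omega, by omega, by omega⟩ (by omega), by rw [uv_mkV, ← hq]⟩
  · refine ⟨mkV (q 0 + q 1) (q 0 - q 1) 1 ⟨by omega, by omega, by omega⟩ (by omega), by rw [uv_mkV, ← hq]⟩
  · refine ⟨mkV (q 0 + q 1) (q 0 - q 1) 2 ⟨by omega, by omega, by omega⟩ (by omega), by rw [uv_mkV, ← hq]⟩

/-! ## §2 Lifts of lattice squares are connected -/

/-- Joined inside the lift of a column set `S`: a walk all of whose vertices lie over `S`. [folklore] -/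
def JoinedIn (S : Set (Site 2)) (a b : diamondFilm k) : Prop :=
  ∃ p : (diamondGraph.induce (diamondFilm k)).Walk a b, ∀ v ∈ p.support, uv v ∈ S

/-- `JoinedIn S` is reflexive on vertices over `S`. [folklore] -/
theorem JoinedIn.refl {S : Set (Site 2)} {a : diamondFilm k} (ha : uv a ∈ S) : JoinedIn S a a :=
  ⟨Walk.nil, fun v hv => by rw [Walk.support_nil, List.mem_singleton] at hv; rw [hv]; exact ha⟩

/-- `JoinedIn S` is symmetric. [folklore] -/
theorem JoinedIn.symm {S : Set (Site 2)} {a b : diamondFilm k} (h : JoinedIn S a b) : JoinedIn S b a := by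
  obtain ⟨p, hp⟩ := h
  exact ⟨p.reverse, fun v hv => hp v (by rw [Walk.support_reverse, List.mem_reverse] at hv; exact hv)⟩

/-- `JoinedIn S` is transitive. [folklore] -/
theorem JoinedIn.trans {S : Set (Site 2)} {a b c : diamondFilm k} (h₁ : JoinedIn S a b) (h₂ : JoinedIn S b c) : JoinedIn S a c := by
  obtain ⟨p, hp⟩ := h₁
  obtain ⟨q, hq⟩ := h₂
  refine ⟨p.append q, fun v hv => ?_⟩
  rw [Walk.support_append, List.mem_append] at hv
  rcases hv with hv | hv
  · exact hp v hv
  · exact hq v (List.tail_subset _ hv)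

/-- One edge between vertices over `S`. [folklore] -/
theorem JoinedIn.of_adj {S : Set (Site 2)} {a b : diamondFilm k} (h : (diamondGraph.induce (diamondFilm k)).Adj a b) (ha : uv a ∈ S) (hb : uv b ∈ S) :
    JoinedIn S a b :=
  ⟨Walk.cons h Walk.nil, fun v hv => by
    rw [Walk.support_cons, Walk.support_nil, List.mem_cons, List.mem_singleton] at hv
    rcases hv with hv | hv <;> rw [hv] <;> assumption⟩

/-- Integer halving arithmetic for the shadow of a bond. [folklore] -/
private theorem half_add_add (a b σ : ℤ) : (a + σ + (b + σ)) / 2 = (a + b) / 2 + σ := by omega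

/-- Integer halving arithmetic for the shadow of a bond. [folklore] -/
private theorem half_sub_add (a b σ : ℤ) : (a + σ - (b + σ)) / 2 = (a - b) / 2 := by
  have : a + σ - (b + σ) = a - b := by ring
  rw [this]

/-- Integer halving arithmetic for the shadow of a bond. [folklore] -/
private theorem half_add_sub (a b σ : ℤ) : (a + σ + (b - σ)) / 2 = (a + b) / 2 := by
  have : a + σ + (b - σ) = a + b := by ring
  rw [this]

/-- Integer halving arithmetic for the shadow of a bond. [folklore] -/
private theorem half_sub_sub (a b σ : ℤ) : (a + σ - (b - σ)) / 2 = (a - b) / 2 + σ := by omega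

/-- **A bond to prescribed coordinates**: if `(y₀, y₁, ℓ)` are diamond coordinates of height `≤ k` differing from those of `x` by `±1` each, the vertex there is a neighbour of `x`.
[cite: ConwaySloane1999, Ch. 4 §7.3] -/
theorem exists_adj_mk (x : diamondFilm k) (y₀ y₁ : ℤ) (ℓ : ℕ) (hℓ : ℓ ≤ k)
    (hfit : y₀ % 2 = (ℓ : ℤ) % 2 ∧ y₁ % 2 = (ℓ : ℤ) % 2 ∧ ((y₀ + y₁ + ℓ) % 4 = 0 ∨ (y₀ + y₁ + ℓ) % 4 = 3))
    (hd : (crd x 0 - y₀ = 1 ∨ crd x 0 - y₀ = -1) ∧ (crd x 1 - y₁ = 1 ∨ crd x 1 - y₁ = -1) ∧ (crd x 2 - ℓ = 1 ∨ crd x 2 - ℓ = -1)) :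
    ∃ y : diamondFilm k, (diamondGraph.induce (diamondFilm k)).Adj x y ∧ crd y 0 = y₀ ∧ crd y 1 = y₁ ∧ crd y 2 = ℓ := by
  refine ⟨mkV y₀ y₁ ℓ hfit hℓ, ?_, rfl, rfl, rfl⟩
  rw [adj_iff_crd]
  obtain ⟨c0, c1, c2⟩ := crd_mkV (k := k) y₀ y₁ ℓ hfit hℓ
  intro i; fin_cases i
  · show crd x 0 - crd (mkV y₀ y₁ ℓ hfit hℓ) 0 = 1 ∨ crd x 0 - crd (mkV y₀ y₁ ℓ hfit hℓ) 0 = -1; rw [c0]; exact hd.1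
  · show crd x 1 - crd (mkV y₀ y₁ ℓ hfit hℓ) 1 = 1 ∨ crd x 1 - crd (mkV y₀ y₁ ℓ hfit hℓ) 1 = -1; rw [c1]; exact hd.2.1
  · show crd x 2 - crd (mkV y₀ y₁ ℓ hfit hℓ) 2 = 1 ∨ crd x 2 - crd (mkV y₀ y₁ ℓ hfit hℓ) 2 = -1; rw [c2]; exact hd.2.2

/-- **A horizontal bond**: between heights `m` (even) and `m + 1`, from `x` at one of them to the vertex at the other over `uv x + σ e₀`, `σ = ±1`.
[cite: ConwaySloane1999, Ch. 4 §7.3] -/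
theorem exists_adj_horiz (x : diamondFilm k) (m : ℕ) (hm : (m : ℤ) % 2 = 0) (hx : crd x 2 = m ∨ crd x 2 = m + 1) (hmk : m + 1 ≤ k) (σ : ℤ)
    (hσ : σ = 1 ∨ σ = -1) :
    ∃ y : diamondFilm k, (diamondGraph.induce (diamondFilm k)).Adj x y ∧ crd y 2 = 2 * m + 1 - crd x 2 ∧ uv y = uv x + σ • Pi.single 0 1 := by
  obtain ⟨p0, p1, p2, -, -⟩ := crd_facts x
  obtain ⟨e0, e1⟩ := uv_apply x
  have key : ∀ ℓ : ℕ, ℓ ≤ k → (crd x 2 - ℓ = 1 ∨ crd x 2 - ℓ = -1) → (ℓ : ℤ) = 2 * m + 1 - crd x 2 →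
      ∃ y : diamondFilm k, (diamondGraph.induce (diamondFilm k)).Adj x y ∧ crd y 2 = 2 * m + 1 - crd x 2 ∧ uv y = uv x + σ • Pi.single 0 1 := by
    intro ℓ hℓ hdℓ hℓeq
    obtain ⟨y, hy, c0, c1, c2⟩ := exists_adj_mk x (crd x 0 + σ) (crd x 1 + σ) ℓ hℓ
      ⟨by omega, by omega, by omega⟩ ⟨by omega, by omega, hdℓ⟩
    obtain ⟨f0, f1⟩ := uv_apply y
    refine ⟨y, hy, by rw [c2, hℓeq], ?_⟩
    clear hy
    ext i; fin_cases i
    · show uv y 0 = (uv x + σ • (Pi.single 0 1 : Site 2)) 0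
      rw [f0, c0, c1, Pi.add_apply, Pi.smul_apply, e0, Pi.single_eq_same, smul_eq_mul, mul_one]; exact half_add_add _ _ _
    · show uv y 1 = (uv x + σ • (Pi.single 0 1 : Site 2)) 1
      rw [f1, c0, c1, Pi.add_apply, Pi.smul_apply, e1, Pi.single_eq_of_ne (by decide : (1 : Fin 2) ≠ 0), smul_zero, add_zero]
      exact half_sub_add _ _ _
  rcases hx with h | h
  · exact key (m + 1) hmk (by push_cast; omega) (by push_cast; omega)
  · exact key m (by omega) (by omega) (by omega)

/-- **A vertical bond**: between heights `m` (odd) and `m + 1`, from `x` at one of them to the vertex at the other over `uv x + σ e₁`, `σ = ±1`.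
[cite: ConwaySloane1999, Ch. 4 §7.3] -/
theorem exists_adj_vert (x : diamondFilm k) (m : ℕ) (hm : (m : ℤ) % 2 = 1) (hx : crd x 2 = m ∨ crd x 2 = m + 1) (hmk : m + 1 ≤ k) (σ : ℤ)
    (hσ : σ = 1 ∨ σ = -1) :
    ∃ y : diamondFilm k, (diamondGraph.induce (diamondFilm k)).Adj x y ∧ crd y 2 = 2 * m + 1 - crd x 2 ∧ uv y = uv x + σ • Pi.single 1 1 := by
  obtain ⟨p0, p1, p2, -, -⟩ := crd_facts x
  obtain ⟨e0, e1⟩ := uv_apply x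
  have key : ∀ ℓ : ℕ, ℓ ≤ k → (crd x 2 - ℓ = 1 ∨ crd x 2 - ℓ = -1) → (ℓ : ℤ) = 2 * m + 1 - crd x 2 →
      ∃ y : diamondFilm k, (diamondGraph.induce (diamondFilm k)).Adj x y ∧ crd y 2 = 2 * m + 1 - crd x 2 ∧ uv y = uv x + σ • Pi.single 1 1 := by
    intro ℓ hℓ hdℓ hℓeq
    obtain ⟨y, hy, c0, c1, c2⟩ := exists_adj_mk x (crd x 0 + σ) (crd x 1 - σ) ℓ hℓ
      ⟨by omega, by omega, by omega⟩ ⟨by omega, by omega, hdℓ⟩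
    obtain ⟨f0, f1⟩ := uv_apply y
    refine ⟨y, hy, by rw [c2, hℓeq], ?_⟩
    clear hy
    ext i; fin_cases i
    · show uv y 0 = (uv x + σ • (Pi.single 1 1 : Site 2)) 0
      rw [f0, c0, c1, Pi.add_apply, Pi.smul_apply, e0, Pi.single_eq_of_ne (by decide : (0 : Fin 2) ≠ 1), smul_zero, add_zero]
      exact half_add_sub _ _ _
    · show uv y 1 = (uv x + σ • (Pi.single 1 1 : Site 2)) 1
      rw [f1, c0, c1, Pi.add_apply, Pi.smul_apply, e1, Pi.single_eq_same, smul_eq_mul, mul_one]; exact half_sub_sub _ _ _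
  rcases hx with h | h
  · exact key (m + 1) hmk (by push_cast; omega) (by push_cast; omega)
  · exact key m (by omega) (by omega) (by omega)

/-- Coordinates of a shifted column. [folklore] -/
theorem add_single_apply (q : Site 2) (σ : ℤ) (i : Fin 2) :
    (q + σ • (Pi.single i 1 : Site 2)) i = q i + σ ∧ ∀ j, j ≠ i → (q + σ • (Pi.single i 1 : Site 2)) j = q j := by
  refine ⟨by rw [Pi.add_apply, Pi.smul_apply, Pi.single_eq_same, smul_eq_mul, mul_one], fun j hj => ?_⟩
  rw [Pi.add_apply, Pi.smul_apply, Pi.single_eq_of_ne hj, smul_zero, add_zero]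

/-- **Inside a square of radius `≥ 1` one can always step in direction `i` with some sign.** [folklore] -/
theorem exists_sign_step_mem {c : Site 2} {u : ℕ} (hu : 1 ≤ u) {q : Site 2} (hq : q ∈ sqBall c u) (i : Fin 2) :
    ∃ σ : ℤ, (σ = 1 ∨ σ = -1) ∧ q + σ • (Pi.single i 1 : Site 2) ∈ sqBall c u := by
  rw [mem_sqBall_iff_linear] at hq
  obtain ⟨h1, h2, h3, h4⟩ := hq
  have hq' : ∀ j : Fin 2, c j - u ≤ q j ∧ q j ≤ c j + u := by
    intro j; fin_cases j
    · exact ⟨h1, h2⟩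
    · exact ⟨h3, h4⟩
  have main : ∀ σ : ℤ, (σ = 1 ∨ σ = -1) → c i - u ≤ q i + σ → q i + σ ≤ c i + u → q + σ • (Pi.single i 1 : Site 2) ∈ sqBall c u := by
    intro σ _ hlo hhi
    obtain ⟨hi, hj⟩ := add_single_apply q σ i
    have key : ∀ j : Fin 2, c j - u ≤ (q + σ • (Pi.single i 1 : Site 2)) j ∧ (q + σ • (Pi.single i 1 : Site 2)) j ≤ c j + u := by
      intro j
      by_cases hji : j = i
      · subst hji; rw [hi]; exact ⟨hlo, hhi⟩
      · rw [hj j hji]; exact hq' j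
    rw [mem_sqBall_iff_linear]
    exact ⟨(key 0).1, (key 0).2, (key 1).1, (key 1).2⟩
  obtain ⟨hlo, hhi⟩ := hq' i
  by_cases hle : q i ≤ c i
  · exact ⟨1, Or.inl rfl, main 1 (Or.inl rfl) (by omega) (by omega)⟩
  · exact ⟨-1, Or.inr rfl, main (-1) (Or.inr rfl) (by omega) (by omega)⟩

/-- **Every vertex over a square of radius `≥ 1` is joined, inside the square, to a vertex of height `1`** (`k ≥ 1`): up from height `0` (horizontal step), down from
heights `≥ 2` one step at a time, the sign of each step chosen to stay inside. [cite: ConwaySloane1999, Ch. 4 §7.3] -/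
theorem exists_joined_height_one (hk : 1 ≤ k) {c : Site 2} {u : ℕ} (hu : 1 ≤ u) :
    ∀ (n : ℕ) (x : diamondFilm k), crd x 2 ≤ n → uv x ∈ sqBall c u → ∃ y : diamondFilm k, crd y 2 = 1 ∧ uv y ∈ sqBall c u ∧ JoinedIn (sqBall c u) x y := by
  intro n
  induction n with
  | zero =>
    intro x hx0 hxS
    obtain ⟨-, -, -, h3, -⟩ := crd_facts x
    have h0 : crd x 2 = 0 := by omega
    obtain ⟨σ, hσ, hmem⟩ := exists_sign_step_mem hu hxS 0
    obtain ⟨y, hy, hy2, hyuv⟩ := exists_adj_horiz x 0 (by decide) (Or.inl (by rw [h0]; rfl)) hk σ hσ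
    refine ⟨y, by rw [hy2, h0]; rfl, by rw [hyuv]; exact hmem, JoinedIn.of_adj hy hxS (by rw [hyuv]; exact hmem)⟩
  | succ n ih =>
    intro x hxn hxS
    by_cases hle : crd x 2 ≤ n
    · exact ih x hle hxS
    · have hx2 : crd x 2 = n + 1 := by omega
      rcases Nat.eq_zero_or_pos n with hn | hn
      · subst hn
        exact ⟨x, by rw [hx2]; rfl, hxS, JoinedIn.refl hxS⟩
      · -- step down from height `n + 1 ≥ 2` to height `n`
        obtain ⟨-, -, -, -, h4⟩ := crd_facts x
        have hnk : n + 1 ≤ k := by exact_mod_cast (hx2 ▸ h4 : ((n : ℤ) + 1) ≤ k)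
        rcases Nat.even_or_odd n with hev | hod
        · obtain ⟨σ, hσ, hmem⟩ := exists_sign_step_mem hu hxS 0
          have hpar : (n : ℤ) % 2 = 0 := by obtain ⟨r, hr⟩ := hev; omega
          obtain ⟨y, hy, hy2, hyuv⟩ := exists_adj_horiz x n hpar (Or.inr (by rw [hx2])) hnk σ hσ
          have hy2' : crd y 2 = n := by rw [hy2, hx2]; ring
          obtain ⟨w, hw1, hwS, hJ⟩ := ih y hy2'.le (by rw [hyuv]; exact hmem)
          exact ⟨w, hw1, hwS, (JoinedIn.of_adj hy hxS (by rw [hyuv]; exact hmem)).trans hJ⟩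
        · obtain ⟨σ, hσ, hmem⟩ := exists_sign_step_mem hu hxS 1
          have hpar : (n : ℤ) % 2 = 1 := by obtain ⟨r, hr⟩ := hod; omega
          obtain ⟨y, hy, hy2, hyuv⟩ := exists_adj_vert x n hpar (Or.inr (by rw [hx2])) hnk σ hσ
          have hy2' : crd y 2 = n := by rw [hy2, hx2]; ring
          obtain ⟨w, hw1, hwS, hJ⟩ := ih y hy2'.le (by rw [hyuv]; exact hmem)
          exact ⟨w, hw1, hwS, (JoinedIn.of_adj hy hxS (by rw [hyuv]; exact hmem)).trans hJ⟩

/-- The shadow of a vertex of height `1` is `≡ (1, 0) mod 2`. [cite: ConwaySloane1999, Ch. 4 §7.3] -/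
theorem uv_parity_of_height_one (x : diamondFilm k) (h : crd x 2 = 1) : uv x 0 % 2 = 1 ∧ uv x 1 % 2 = 0 := by
  obtain ⟨p0, p1, p2, -, -⟩ := crd_facts x
  obtain ⟨e0, e1⟩ := crd_eq_of_uv x
  rw [h] at p0 p1 p2
  rw [e0, e1] at p2
  rw [e0] at p0
  constructor <;> omega

/-- Two vertices of the same height over the same column coincide. [folklore] -/
theorem eq_of_uv_eq_of_height_eq {x y : diamondFilm k} (huv : uv x = uv y) (h : crd x 2 = crd y 2) : x = y := by
  obtain ⟨a0, a1⟩ := crd_eq_of_uv x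
  obtain ⟨b0, b1⟩ := crd_eq_of_uv y
  apply ext_crd; intro i; fin_cases i
  · show crd x 0 = crd y 0; rw [a0, b0, huv]
  · show crd x 1 = crd y 1; rw [a1, b1, huv]
  · exact h

/-- A point between two points of a square (in one coordinate, the other fixed) lies in the square. [folklore] -/
theorem mem_sqBall_between {c : Site 2} {u : ℕ} {p q r : Site 2} (hp : p ∈ sqBall c u) (hq : q ∈ sqBall c u) (i : Fin 2)
    (hlo : min (p i) (q i) ≤ r i) (hhi : r i ≤ max (p i) (q i)) (hj : ∀ j, j ≠ i → r j = p j) : r ∈ sqBall c u := by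
  rw [mem_sqBall_iff_linear] at hp hq ⊢
  fin_cases i
  · have := hj 1 (by decide); change r 1 = p 1 at this
    change min (p 0) (q 0) ≤ r 0 at hlo; change r 0 ≤ max (p 0) (q 0) at hhi
    rw [min_le_iff] at hlo; rw [le_max_iff] at hhi; omega
  · have := hj 0 (by decide); change r 0 = p 0 at this
    change min (p 1) (q 1) ≤ r 1 at hlo; change r 1 ≤ max (p 1) (q 1) at hhi
    rw [min_le_iff] at hlo; rw [le_max_iff] at hhi; omega

/-- Order facts for a double step of sign `σ` from `a` towards `b`, `|a − b| ≥ 2`. [folklore] -/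
private theorem between_facts {a b σ : ℤ} (h : (σ = 1 ∧ a + 2 ≤ b) ∨ (σ = -1 ∧ b + 2 ≤ a)) :
    min a b ≤ a + σ ∧ a + σ ≤ max a b ∧ min a b ≤ a + 2 * σ ∧ a + 2 * σ ≤ max a b ∧ |a + 2 * σ - b| + 2 = |a - b| := by
  rcases h with ⟨rfl, h⟩ | ⟨rfl, h⟩
  · rw [min_eq_left (by omega), max_eq_right (by omega), abs_of_nonpos (by omega), abs_of_nonpos (by omega)]; omega
  · rw [min_eq_right (by omega), max_eq_left (by omega), abs_of_nonneg (by omega), abs_of_nonneg (by omega)]; omega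

/-- **Any two vertices of height `1` over a square of radius `≥ 1` are joined inside it** (`k ≥ 2`; radius `≥ 1` is not even needed): double steps through height `0` move the column by `±2e₀`, double
steps through height `2` by `±2e₁`; induction on the lattice distance. [cite: ConwaySloane1999, Ch. 4 §7.3] -/
theorem joined_of_height_one (hk : 2 ≤ k) {c : Site 2} {u : ℕ} :
    ∀ (d : ℕ) (x y : diamondFilm k), (|uv x 0 - uv y 0| + |uv x 1 - uv y 1|).toNat ≤ d → crd x 2 = 1 → crd y 2 = 1 →
      uv x ∈ sqBall c u → uv y ∈ sqBall c u → JoinedIn (sqBall c u) x y := by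
  intro d
  induction d using Nat.strong_induction_on with
  | _ d ih =>
    intro x y hd hx1 hy1 hxS hyS
    obtain ⟨px0, px1⟩ := uv_parity_of_height_one x hx1
    obtain ⟨py0, py1⟩ := uv_parity_of_height_one y hy1
    by_cases h0 : uv x 0 = uv y 0
    · by_cases h1 : uv x 1 = uv y 1
      · have : x = y := eq_of_uv_eq_of_height_eq (by ext i; fin_cases i; exacts [h0, h1]) (by rw [hx1, hy1])
        subst this; exact JoinedIn.refl hxS
      · -- vertical double step through height `2`
        obtain ⟨σ, hσ'⟩ : ∃ σ : ℤ, (σ = 1 ∧ uv x 1 + 2 ≤ uv y 1) ∨ (σ = -1 ∧ uv y 1 + 2 ≤ uv x 1) := by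
          rcases lt_or_gt_of_ne h1 with hlt | hlt
          · exact ⟨1, Or.inl ⟨rfl, by omega⟩⟩
          · exact ⟨-1, Or.inr ⟨rfl, by omega⟩⟩
        have hσ : σ = 1 ∨ σ = -1 := hσ'.elim (fun h => Or.inl h.1) (fun h => Or.inr h.1)
        obtain ⟨m1, m2, m3, m4, habs⟩ := between_facts hσ'
        obtain ⟨x₁, hx₁, hx₁2, hx₁uv⟩ := exists_adj_vert x 1 (by decide) (Or.inl (by rw [hx1]; rfl)) hk σ hσ
        have hx₁2' : crd x₁ 2 = 2 := by rw [hx₁2, hx1]; rfl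
        obtain ⟨x₂, hx₂, hx₂2, hx₂uv⟩ := exists_adj_vert x₁ 1 (by decide) (Or.inr (by rw [hx₁2']; rfl)) hk σ hσ
        have hx₂2' : crd x₂ 2 = 1 := by rw [hx₂2, hx₁2']; rfl
        obtain ⟨a1, a0⟩ := add_single_apply (uv x) σ 1
        obtain ⟨b1, b0⟩ := add_single_apply (uv x₁) σ 1
        have hx₁0 : uv x₁ 0 = uv x 0 := by rw [hx₁uv]; exact a0 0 (by decide)
        have hx₁1 : uv x₁ 1 = uv x 1 + σ := by rw [hx₁uv]; exact a1
        have hx₂0 : uv x₂ 0 = uv x 0 := by rw [hx₂uv, b0 0 (by decide), hx₁0]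
        have hx₂1 : uv x₂ 1 = uv x 1 + 2 * σ := by rw [hx₂uv, b1, hx₁1]; ring
        have hx₁S : uv x₁ ∈ sqBall c u :=
          mem_sqBall_between hxS hyS 1 (by rw [hx₁1]; exact m1) (by rw [hx₁1]; exact m2) (fun j hj => by fin_cases j <;> first | exact hx₁0 | exact absurd rfl hj)
        have hx₂S : uv x₂ ∈ sqBall c u :=
          mem_sqBall_between hxS hyS 1 (by rw [hx₂1]; exact m3) (by rw [hx₂1]; exact m4) (fun j hj => by fin_cases j <;> first | exact hx₂0 | exact absurd rfl hj)
        have hlt : (|uv x₂ 0 - uv y 0| + |uv x₂ 1 - uv y 1|).toNat < d := by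
          rw [hx₂0, hx₂1, h0, sub_self, abs_zero, zero_add]
          rw [h0, sub_self, abs_zero, zero_add, ← habs] at hd
          have : (0 : ℤ) ≤ |uv x 1 + 2 * σ - uv y 1| := abs_nonneg _
          omega
        exact ((JoinedIn.of_adj hx₁ hxS hx₁S).trans (JoinedIn.of_adj hx₂ hx₁S hx₂S)).trans (ih _ hlt x₂ y le_rfl hx₂2' hy1 hx₂S hyS)
    · -- horizontal double step through height `0`
      obtain ⟨σ, hσ'⟩ : ∃ σ : ℤ, (σ = 1 ∧ uv x 0 + 2 ≤ uv y 0) ∨ (σ = -1 ∧ uv y 0 + 2 ≤ uv x 0) := by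
        rcases lt_or_gt_of_ne h0 with hlt | hlt
        · exact ⟨1, Or.inl ⟨rfl, by omega⟩⟩
        · exact ⟨-1, Or.inr ⟨rfl, by omega⟩⟩
      have hσ : σ = 1 ∨ σ = -1 := hσ'.elim (fun h => Or.inl h.1) (fun h => Or.inr h.1)
      obtain ⟨m1, m2, m3, m4, habs⟩ := between_facts hσ'
      obtain ⟨x₁, hx₁, hx₁2, hx₁uv⟩ := exists_adj_horiz x 0 (by decide) (Or.inr (by rw [hx1]; rfl)) (by omega) σ hσ
      have hx₁2' : crd x₁ 2 = 0 := by rw [hx₁2, hx1]; rfl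
      obtain ⟨x₂, hx₂, hx₂2, hx₂uv⟩ := exists_adj_horiz x₁ 0 (by decide) (Or.inl (by rw [hx₁2']; rfl)) (by omega) σ hσ
      have hx₂2' : crd x₂ 2 = 1 := by rw [hx₂2, hx₁2']; rfl
      obtain ⟨a0, a1⟩ := add_single_apply (uv x) σ 0
      obtain ⟨b0, b1⟩ := add_single_apply (uv x₁) σ 0
      have hx₁1 : uv x₁ 1 = uv x 1 := by rw [hx₁uv]; exact a1 1 (by decide)
      have hx₁0 : uv x₁ 0 = uv x 0 + σ := by rw [hx₁uv]; exact a0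
      have hx₂1 : uv x₂ 1 = uv x 1 := by rw [hx₂uv, b1 1 (by decide), hx₁1]
      have hx₂0 : uv x₂ 0 = uv x 0 + 2 * σ := by rw [hx₂uv, b0, hx₁0]; ring
      have hx₁S : uv x₁ ∈ sqBall c u :=
        mem_sqBall_between hxS hyS 0 (by rw [hx₁0]; exact m1) (by rw [hx₁0]; exact m2) (fun j hj => by fin_cases j <;> first | exact hx₁1 | exact absurd rfl hj)
      have hx₂S : uv x₂ ∈ sqBall c u :=
        mem_sqBall_between hxS hyS 0 (by rw [hx₂0]; exact m3) (by rw [hx₂0]; exact m4) (fun j hj => by fin_cases j <;> first | exact hx₂1 | exact absurd rfl hj)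
      have hlt : (|uv x₂ 0 - uv y 0| + |uv x₂ 1 - uv y 1|).toNat < d := by
        rw [hx₂0, hx₂1]
        rw [← habs] at hd
        have : (0 : ℤ) ≤ |uv x 0 + 2 * σ - uv y 0| := abs_nonneg _
        have : (0 : ℤ) ≤ |uv x 1 - uv y 1| := abs_nonneg _
        omega
      exact ((JoinedIn.of_adj hx₁ hxS hx₁S).trans (JoinedIn.of_adj hx₂ hx₁S hx₂S)).trans (ih _ hlt x₂ y le_rfl hx₂2' hy1 hx₂S hyS)

/-- **THE LIFT OF EVERY LATTICE SQUARE OF RADIUS `≥ 1` IS CONNECTED INSIDE ITSELF** (`k ≥ 2`) — the structural hypothesis `hconn` of «SqShadowVRoutingX» for `D_k`.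
[cite: ConwaySloane1999, Ch. 4 §7.3] -/
theorem exists_walk_in_lift_sqBall (hk : 2 ≤ k) (hke : Even k) (c : Site 2) (u : ℕ) (hu : 1 ≤ u) :
    ∀ a ∈ (sqShadow hke).lift (sqBall c u), ∀ b ∈ (sqShadow hke).lift (sqBall c u),
      ∃ p : (diamondGraph.induce (diamondFilm k)).Walk a b, ∀ v ∈ p.support, v ∈ (sqShadow hke).lift (sqBall c u) := by
  intro a ha b hb
  simp only [SqShadow.mem_lift, sqShadow_sh] at ha hb ⊢
  obtain ⟨ya, hya1, hyaS, hJa⟩ := exists_joined_height_one (k := k) (by omega) hu _ a (crd_facts a).2.2.2.2 ha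
  obtain ⟨yb, hyb1, hybS, hJb⟩ := exists_joined_height_one (k := k) (by omega) hu _ b (crd_facts b).2.2.2.2 hb
  obtain ⟨p, hp⟩ := (hJa.trans (joined_of_height_one hk _ ya yb le_rfl hya1 hyb1 hyaS hybS)).trans hJb.symm
  exact ⟨p, hp⟩

/-! ## §3 The even films at their own critical point, modulo the exit-form certificate -/

/-- **`DiamondFilmOwnCriticalContinuity k` FOR EVEN `k ≥ 4` FROM `ShapedLinkageX R` of the square shadow, any `R ≥ 1`** — Duminil-Copin–Sidoravicius–Tassion's proof transplanted to
the film `D_k` (square DST layer «SqShadow*» with the thin-instance routing «SqShadowVRoutingX»: eq. (1), Lemmata 4–7, eqs. (10)–(13), §2.2, Facts 1–2, the exit property of the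
witness PROVED; the instance supplies connectedness, uniqueness, inhabited columns, connected square lifts — all proved here and in «DiamondFilmSqShadow» — and the routing
certificate `ShapedLinkageX R`).  For `k = 4` the certificate holds at `R = 4` with one cleared-set template per centre class (memo §148; to be typed).  Independent of p205010.
[cite: DuminilCopinSidoraviciusTassion2016, Thm. 1 and §2] [cite: BenjaminiSchramm1996, Conj. 4 / Question 3] -/
theorem diamondFilmOwnCriticalContinuity_of_shapedLinkageX (hk4 : 4 ≤ k) (hk : Even k) {R : ℕ} (hR : 1 ≤ R) (hL : (sqShadow hk).ShapedLinkageX R) :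
    DiamondFilmOwnCriticalContinuity k :=
  fun v => (sqShadow hk).theta_criticalProb_eq_zero_of_shapedLinkageX (connected (by omega)) (numInfiniteClusters_le_one (by omega))
    (by rw [sqShadow_sh]; exact uv_surjective (by omega)) (exists_walk_in_lift_sqBall (by omega) hk) hL hR v

/-- In particular for `D_4` at radius `4` (the certified case of memo §148). Independent of p205010. [cite: DuminilCopinSidoraviciusTassion2016, Thm. 1 and §2] -/
theorem diamondFilmOwnCriticalContinuity_four_of_shapedLinkageX (hL : (sqShadow (k := 4) ⟨2, rfl⟩).ShapedLinkageX 4) : DiamondFilmOwnCriticalContinuity 4 :=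
  diamondFilmOwnCriticalContinuity_of_shapedLinkageX le_rfl ⟨2, rfl⟩ (by norm_num) hL

end DiamondFilm

end Summit.CriticalPhenomena.PercolationContinuityZ3.Theorems.Transplant

end
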